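import Literature.AlgebraicGeometry.HodgeTheory.BettiHodgeConjectureProductsHodgeDisjointHodgeNumbers
import Literature.AlgebraicGeometry.HodgeTheory.BettiHodgeNumbersKunneth
import HarnessLib

/-!
# The window criterion for `HC(Y × Z)` in Hodge NUMBERS: `h^{P,Q}(Hⁱ(Y)) · h^{c−P,c−Q}(Hʲ(Z)) = 0` on the reduced window; a threefold times an `n`-fold; two threefolds — `HC(T × T')` unconditionally
# when `h^{1,0}h'^{2,1} = h^{2,1}h'^{1,0} = h^{2,0}h'^{2,0} = h^{3,0}h'^{3,0} = h^{2,1}h'^{2,1} = 0`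
# (Voisin I §6.1.3 Cor. 6.13, §6.2.3 Thm. 6.25, §7.1.1, §11.3.3 Thm. 11.38–11.40, Lemma 11.41, pp. 285–287, Thm. 11.30; Voisin II §11.1.1, Prop. 9.20; Deligne Hodge II 1.2.5, 2.1.13)

Family `hodge`, lane `lit-hodgefound` (Track 2 foundations library; Layers A1/A4), layer `Literature/AlgebraicGeometry/HodgeTheory`.  THEOREMS ONLY (no definition, no named fact, no instance;
D-0026 net debt `0`).

The seat's g31-#16 (`BettiUniverse.hodgeConjectureFor_tensor_of_forall_reducedWindow_hodgeDisjoint`) proves `HC(Y × Z)` from `HC(Y)`, `HC(Z)` and the HODGE-DISJOINTNESS of every reduced-window pair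
(`Hᵃ(Z)`, `Hⁱ(Y)(r)`), `a + j = 2n`, `n + r = c`, stated on the Hodge PIECES: for every `p`, `Hᵃ(Z)^{p,a−p} = 0` or `Hⁱ(Y)^{p+r,a−p+r} = 0`.  By Serre–Poincaré duality of the Hodge numbers
(`h^{p,a−p}(H^{2n−j}(Z)) = h^{n−p, p−n+j}(Hʲ(Z))`, §1, integer indices) and `H^{p,q} = 0 ⟺ h^{p,q} = 0` (g31-#18), the condition is the vanishing of the products
**`h^{P,Q}(Hⁱ(Y)) · h^{c−P, c−Q}(Hʲ(Z))`, `P + Q = i`** — i.e. NO type `(P,Q)` of `Hⁱ(Y)` and `(P',Q')` of `Hʲ(Z)` add up to the Hodge type `(c,c)` of `H^{2c}(Y × Z)`, which is how one reads off, from the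
Hodge diamonds of the factors alone, that the Künneth piece `Hⁱ(Y) ⊗ Hʲ(Z)` carries no Hodge class (Voisin I §11.3.3, pp. 285–287: the Hodge classes of `Hⁱ(Y) ⊗ Hʲ(Z)` are the morphisms of
Hodge structures `H^{2n−j}(Z) → Hⁱ(Y)` of the right bidegree; Deligne 1.2.5: `(V ⊗ W)^{P,Q} = ⊕ V^{a,b} ⊗ W^{P−a,Q−b}`).  §2 states the criterion in this form (integer and natural indices); §3 spells it
out for a THREEFOLD first factor (`i ∈ {1, 2, 3}`; the `C × X` and `S × X` cases are g31-#17/#18); §4 takes `X = T'` a second threefold, where `HC(T)`, `HC(T')` are the tree's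
`hodgeConjectureFor_of_dim_le_three_holds`, and obtains **`HC(T × T')` UNCONDITIONALLY for every pair of smooth projective threefolds with
`h^{1,0}(T)h^{2,1}(T') = h^{2,1}(T)h^{1,0}(T') = h^{2,0}(T)h^{2,0}(T') = h^{3,0}(T)h^{3,0}(T') = h^{2,1}(T)h^{2,1}(T') = 0`** — e.g. any threefold with `h^{3,0} = 0` times a threefold with
`h^{1,0} = h^{2,0} = h^{2,1} = 0` (a rigid Calabi–Yau threefold, say), and the self-product `T × T` of a threefold with `h^{2,0} = h^{3,0} = h^{2,1} = 0`.  (Two rigid Calabi–Yau threefolds are NOT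
covered: `h^{3,0}h'^{3,0} = 1`, the piece `H³(T) ⊗ H³(T')` may carry Hodge classes = morphisms `H³(T') → H³(T)`.)  The tree's `BettiUniverse.hodgeConjectureFor_tensor_threefolds_of_hom` states the
`T × T'` criterion with hypotheses on the `Hom_HS` spaces; here the hypotheses are numerical.

WHAT IS PROVED.
* §1 **`BettiUniverse.hodgeNumber_hodge_eq_zero_of_dim_lt_fst'` / `…_snd'`** (`h^{a,b}(Hᵏ(X)) = 0` for `a > dim X` or `b > dim X`, integer indices) and
  **`BettiUniverse.hodgeNumber_hodge_duality_int`**: `h^{p, a−p}(Hᵃ(X)) = h^{n−p, p−n+j}(Hʲ(X))` for `a + j = 2n` and every `p ∈ ℤ`.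
* §2 **`BettiUniverse.hodgeConjectureFor_tensor_of_forall_reducedWindow_hodgeNumber_mul_eq_zero`** (and `…_nat`): `HC(Y)`, `HC(Z)` and, on every reduced-window triple (`2 ≤ c`, `1 ≤ i ≤ m`,
  `1 ≤ j ≤ n`, `i + j = 2c`, `bᵢ(Y) ≠ 0`, `bⱼ(Z) ≠ 0`, no factor consisting of Hodge classes), `h^{P,Q}(Hⁱ(Y)) · h^{c−P,c−Q}(Hʲ(Z)) = 0` for all `P + Q = i` ⟹ `HC(Y × Z)`.
* §3 **`BettiUniverse.hodgeConjectureFor_threefold_tensor_of_hodgeNumber_mul_eq_zero`**: `HC(T × X)` from `HC(X)` and `h^{2,1}(T)·h^{b,b+1}(H^{2b+1}(X)) = 0` (`2b + 1 ≤ n`),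
  `h^{1,0}(T)·h^{b,b+1}(H^{2b+1}(X)) = 0` (`1 ≤ b`, `2b + 1 ≤ n`), `h^{3,0}(T)·h^{u,u+3}(H^{2u+3}(X)) = 0` (`2u + 3 ≤ n`), [`h^{2,0}(T) = 0` or `Hdgᵇ(H^{2b}(X)) = H^{2b}(X;ℚ)`] (`1 ≤ b`, `2b ≤ n`).
* §4 **`BettiUniverse.hodgeConjectureFor_tensor_threefolds_of_hodgeNumber_mul_eq_zero`** (the five products above), **`…_of_hodgeNumber_eq_zero_right` / `…_left`** (one factor with
  `h^{1,0} = h^{2,0} = h^{2,1} = 0`, and `h^{3,0}h'^{3,0} = 0`), **`BettiUniverse.hodgeConjectureFor_tensor_self_threefold_of_hodgeNumber_eq_zero`** (`h^{2,0} = h^{3,0} = h^{2,1} = 0`).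

THE PRINTS.  C. Voisin (2002) [VoisinHodgeI2002] §6.1.3 Cor. 6.13 (`H^{p,q} ≅ H^q(Ω^p)`, so `h^{p,q} = 0` off `0 ≤ p, q ≤ n`); §6.2.3 Thm. 6.25 and §6.3.2 proof of Thm. 6.33 (Lefschetz / Serre duality
`h^{p,q} = h^{n−p,n−q}`); §7.1.1 (Hodge structures, `h^{p,q}`, Hodge symmetry); §11.3.3 Thm. 11.38–11.40, Lemma 11.41 and pp. 285–287 (Künneth, Hodge classes of a tensor product as morphisms of Hodge
structures); §11.3.1 Thm. 11.30 (Lefschetz `(1,1)`).  C. Voisin (2003) [VoisinHodgeII2003] §9.2.4 Prop. 9.20; §10.2.3 proof of Prop. 10.26; §11.1.1.  P. Deligne (1971) [DeligneHodgeII1971] 1.2.5,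
2.1.13.  P. Deligne (2000/2006) [Deligne2000] §1 (the statement `HC(X)`).

THE OBJECTS (all the tree's).  `BettiUniverse.hodge`, `HodgeStructure.hodgeNumber`, `HodgeStructure.piece`, `hodgeClasses`, `bettiCohomology`, `HodgeConjectureFor`; the tree's
`BettiUniverse.hodgeNumber_hodge_duality_of_eq`, `…_eq_zero_of_lt_fst/snd`, `…_eq_zero_of_neg_left/right`, `BettiUniverse.hodgeNumber_hodge_symm`, `BettiUniverse.piece_hodge_eq_bot_iff_hodgeNumber_eq_zero`,
`BettiUniverse.hodgeClasses_hodge_two_eq_top_iff`, `hodgeConjectureFor_of_dim_le_three_holds`, and the seat's g31-#16 `BettiUniverse.hodgeConjectureFor_tensor_of_forall_reducedWindow_hodgeDisjoint`.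

DEVIATIONS / SCOPE.  Complex orientations (through g31-#14/#16).  The exclusion clauses of the reduced window ("`H^{2a'}(Y;ℚ)` consists of Hodge classes") are kept as hypotheses handed to the
user exactly as in g31-#14; in §3/§4 they are discharged through `Hdg¹(H²) = H² ⟺ h^{2,0} = 0`.  No definitions.

## References
* [VoisinHodgeI2002] C. Voisin, *Hodge Theory and Complex Algebraic Geometry I* (2002) — §6.1.3 Cor. 6.13; §6.2.3 Thm. 6.25; §6.3.2; §7.1.1; §11.3.1 Thm. 11.30; §11.3.3 Thm. 11.38–11.40, Lemma 11.41, pp. 285–287.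
* [VoisinHodgeII2003] C. Voisin, *Hodge Theory and Complex Algebraic Geometry II* (2003) — §9.2.4 Prop. 9.20; §10.2.3 proof of Prop. 10.26; §11.1.1.
* [DeligneHodgeII1971] P. Deligne, *Théorie de Hodge II* (1971) — 1.2.5, 2.1.13.
* [Deligne2000] P. Deligne, *The Hodge conjecture* (Clay problem description) — §1.

## Provenance
Lane `lit-hodgefound` (Hodge path, Track 2), prover seat `lit-hodgefound-p29` (generation 33), self-proposed row g33-#1 (gen-31 free pointer (c): the Hodge-disjoint window criteria packaged
numerically, per dimension pair; here the general numerical form and the pairs `3 × n`, `3 × 3`).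
-/

noncomputable section

open scoped TensorProduct
open CategoryTheory MonoidalCategory CartesianMonoidalCategory Module Finset
open Literature.AlgebraicTopology.SingularHomology
open Literature.Geometry.Kaehler

namespace Literature.AlgebraicGeometry.HodgeTheory

open Literature.AlgebraicGeometry.Motives
open Literature.AlgebraicGeometry.Motives.HodgeStructure

variable {m n d : ℕ} {X Y Z T T' : SchemeOver ℂ}

/-! ### §1 Hodge numbers beyond the dimension; Serre–Poincaré duality with integer indices -/

/-- **`h^{a,b}(Hᵏ(X)) = 0` for `a > dim X`** (integer indices; off the weight line every Hodge number vanishes, on it `b = k − a` and the tree's `…_of_lt_fst` / `…_of_neg_right` apply).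
[cite: VoisinHodgeI2002, §6.1.3 Cor. 6.13 and §7.1.1] -/
theorem BettiUniverse.hodgeNumber_hodge_eq_zero_of_dim_lt_fst' (hHD : exists_isReal_hodgeModel) (hX : IsSmoothProjective n X) (k : ℕ) {a : ℤ} (b : ℤ) (ha : (n : ℤ) < a) :
    (BettiUniverse.hodge hHD hX k).hodgeNumber a b = 0 := by
  by_cases hab : a + b = (k : ℤ)
  · by_cases hb : b < 0
    · exact BettiUniverse.hodgeNumber_hodge_eq_zero_of_neg_right hHD hX k a hb
    obtain ⟨a', rfl⟩ : ∃ a' : ℕ, (a' : ℤ) = a := ⟨a.toNat, Int.toNat_of_nonneg (by omega)⟩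
    obtain ⟨b', rfl⟩ : ∃ b' : ℕ, (b' : ℤ) = b := ⟨b.toNat, Int.toNat_of_nonneg (by omega)⟩
    exact BettiUniverse.hodgeNumber_hodge_eq_zero_of_lt_fst hHD hX (by omega) (by omega)
  · exact (BettiUniverse.hodge hHD hX k).hodgeNumber_eq_zero_of_add_ne hab

/-- **`h^{a,b}(Hᵏ(X)) = 0` for `b > dim X`** (integer indices). [cite: VoisinHodgeI2002, §6.1.3 Cor. 6.13 and §7.1.1] -/
theorem BettiUniverse.hodgeNumber_hodge_eq_zero_of_dim_lt_snd' (hHD : exists_isReal_hodgeModel) (hX : IsSmoothProjective n X) (k : ℕ) (a : ℤ) {b : ℤ} (hb : (n : ℤ) < b) :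
    (BettiUniverse.hodge hHD hX k).hodgeNumber a b = 0 := by
  rw [BettiUniverse.hodgeNumber_hodge_symm hHD hX k a b]
  exact BettiUniverse.hodgeNumber_hodge_eq_zero_of_dim_lt_fst' hHD hX k a hb

/-- **Serre–Poincaré duality of the Hodge numbers with integer indices: `h^{p, a−p}(Hᵃ(X)) = h^{n−p, p−n+j}(Hʲ(X))` for `a + j = 2n` and every `p ∈ ℤ`** (`n = dim X`).  On the square
`max(0, n−j) ≤ p ≤ min(a, n)` this is the tree's `BettiUniverse.hodgeNumber_hodge_duality_of_eq` (`h^{p,q}(H^{p+q}) = h^{n−p,n−q}(H^{2n−p−q})`); outside it both sides vanish (a negative index, or an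
index beyond `n`). [cite: VoisinHodgeI2002, §6.2.3 Thm. 6.25, §6.3.2 proof of Thm. 6.33, §6.1.3 Cor. 6.12–6.13 and §7.1.1] -/
theorem BettiUniverse.hodgeNumber_hodge_duality_int (hHD : exists_isReal_hodgeModel) (hX : IsSmoothProjective n X) {a j : ℕ} (haj : a + j = 2 * n) (p : ℤ) :
    (BettiUniverse.hodge hHD hX a).hodgeNumber p (a - p) = (BettiUniverse.hodge hHD hX j).hodgeNumber (n - p) (p - n + j) := by
  by_cases hp0 : p < 0
  · rw [BettiUniverse.hodgeNumber_hodge_eq_zero_of_neg_left hHD hX a _ hp0,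
      BettiUniverse.hodgeNumber_hodge_eq_zero_of_dim_lt_fst' hHD hX j _ (by omega : (n : ℤ) < n - p)]
  by_cases hpa : (a : ℤ) < p
  · rw [BettiUniverse.hodgeNumber_hodge_eq_zero_of_neg_right hHD hX a _ (by omega : (a : ℤ) - p < 0),
      BettiUniverse.hodgeNumber_hodge_eq_zero_of_dim_lt_snd' hHD hX j _ (by omega : (n : ℤ) < p - n + j)]
  by_cases hpn : (n : ℤ) < p
  · rw [BettiUniverse.hodgeNumber_hodge_eq_zero_of_dim_lt_fst' hHD hX a _ hpn,
      BettiUniverse.hodgeNumber_hodge_eq_zero_of_neg_left hHD hX j _ (by omega : (n : ℤ) - p < 0)]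
  by_cases hpj : p - n + j < 0
  · rw [BettiUniverse.hodgeNumber_hodge_eq_zero_of_dim_lt_snd' hHD hX a _ (by omega : (n : ℤ) < a - p),
      BettiUniverse.hodgeNumber_hodge_eq_zero_of_neg_right hHD hX j _ hpj]
  -- the effective square: all four indices are natural numbers and the tree's duality applies
  obtain ⟨P, rfl⟩ : ∃ P : ℕ, (P : ℤ) = p := ⟨p.toNat, Int.toNat_of_nonneg (by omega)⟩
  obtain ⟨Q, hQ⟩ : ∃ Q : ℕ, (Q : ℤ) = (a : ℤ) - P := ⟨a - P, by omega⟩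
  obtain ⟨P', hP'⟩ : ∃ P' : ℕ, (P' : ℤ) = (n : ℤ) - P := ⟨n - P, by omega⟩
  obtain ⟨Q', hQ'⟩ : ∃ Q' : ℕ, (Q' : ℤ) = (P : ℤ) - n + j := ⟨P + j - n, by omega⟩
  rw [← hQ, ← hP', ← hQ']
  exact BettiUniverse.hodgeNumber_hodge_duality_of_eq hHD hX (by omega) (by omega) (by omega) (by omega)

variable [HodgeTensorFacts.{0, 0}]

/-! ### §2 The reduced-window criterion in Hodge numbers -/

/-- **The window criterion for `HC(Y × Z)` in Hodge numbers.**  Let `Y`, `Z` be smooth projective of dimensions `m`, `n` with `HC(Y)` and `HC(Z)`.  Suppose that for every reduced-window triple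
(`2 ≤ c`, `1 ≤ i ≤ m`, `1 ≤ j ≤ n`, `i + j = 2c`, `bᵢ(Y) ≠ 0`, `bⱼ(Z) ≠ 0`, neither `Hⁱ(Y;ℚ)` nor `Hʲ(Z;ℚ)` consisting of Hodge classes) and every `P + Q = i`,
**`h^{P,Q}(Hⁱ(Y)) · h^{c−P,c−Q}(Hʲ(Z)) = 0`** — no Hodge type of `Hⁱ(Y)` and of `Hʲ(Z)` add up to `(c, c)`.  Then `HC(Y × Z)`.  (For the window pair (`H^{2n−j}(Z)`, `Hⁱ(Y)(c−n)`) of g31-#16 and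
every `p`, either `h^{p+c−n, 2n−j−p+c−n}(Hⁱ(Y)) = 0` or, by duality (§1), `h^{p, 2n−j−p}(H^{2n−j}(Z)) = h^{n−p, p−n+j}(Hʲ(Z)) = 0`; these are the two factors at `P = p + c − n`.)
[cite: VoisinHodgeI2002, §7.1.1, §6.2.3 Thm. 6.25, §11.3.3 Thm. 11.38–11.40, Lemma 11.41 and pp. 285–287, §11.3.1 Thm. 11.30] [cite: DeligneHodgeII1971, 1.2.5 and 2.1.13] [cite: VoisinHodgeII2003, §9.2.4 Prop. 9.20]
[cite: Deligne2000, §1] -/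
theorem BettiUniverse.hodgeConjectureFor_tensor_of_forall_reducedWindow_hodgeNumber_mul_eq_zero (hHD : exists_isReal_hodgeModel) (hY : IsSmoothProjective m Y) (hZ : IsSmoothProjective n Z)
    (hYZ : IsSmoothProjective d (Y ⊗ Z)) (hHCY : HodgeConjectureFor m Y) (hHCZ : HodgeConjectureFor n Z)
    (hdis : ∀ c i j : ℕ, 2 ≤ c → 1 ≤ i → i ≤ m → 1 ≤ j → j ≤ n → i + j = 2 * c →
      0 < Module.finrank ℚ (bettiCohomology Y i) → 0 < Module.finrank ℚ (bettiCohomology Z j) →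
      (∀ a', i = 2 * a' → (BettiUniverse.hodge hHD hY (2 * a')).hodgeClasses a' ≠ ⊤) → (∀ b', j = 2 * b' → (BettiUniverse.hodge hHD hZ (2 * b')).hodgeClasses b' ≠ ⊤) →
      ∀ P Q : ℤ, P + Q = i → (BettiUniverse.hodge hHD hY i).hodgeNumber P Q * (BettiUniverse.hodge hHD hZ j).hodgeNumber ((c : ℤ) - P) ((c : ℤ) - Q) = 0) :
    HodgeConjectureFor d (Y ⊗ Z) := by
  refine BettiUniverse.hodgeConjectureFor_tensor_of_forall_reducedWindow_hodgeDisjoint hHD hY hZ hYZ hHCY hHCZ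
    fun c i j a r hc hi him hj hjn hij haj hr hbY hbZ hnY hnZ p ↦ ?_
  have h := hdis c i j hc hi him hj hjn hij hbY hbZ hnY hnZ (p + r) (((a : ℕ) : ℤ) - p + r) (by omega)
  rcases mul_eq_zero.1 h with h | h
  · exact Or.inr ((BettiUniverse.piece_hodge_eq_bot_iff_hodgeNumber_eq_zero hHD hY i _ _).2 h)
  · refine Or.inl ((BettiUniverse.piece_hodge_eq_bot_iff_hodgeNumber_eq_zero hHD hZ a _ _).2 ?_)
    rw [BettiUniverse.hodgeNumber_hodge_duality_int hHD hZ haj p]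
    have e₁ : (c : ℤ) - (p + r) = (n : ℤ) - p := by omega
    have e₂ : (c : ℤ) - (((a : ℕ) : ℤ) - p + r) = p - n + j := by omega
    rwa [e₁, e₂] at h

/-- The same criterion with NATURAL indices: it suffices to check `h^{P,Q}(Hⁱ(Y)) · h^{c−P,c−Q}(Hʲ(Z)) = 0` for `P + Q = i`, `P ≤ c`, `Q ≤ c` (finitely many types; outside this range a factor has a
negative index and vanishes). [cite: VoisinHodgeI2002, §7.1.1, §11.3.3 Lemma 11.41 and pp. 285–287, §11.3.1 Thm. 11.30] [cite: DeligneHodgeII1971, 1.2.5 and 2.1.13] [cite: Deligne2000, §1] -/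
theorem BettiUniverse.hodgeConjectureFor_tensor_of_forall_reducedWindow_hodgeNumber_mul_eq_zero_nat (hHD : exists_isReal_hodgeModel) (hY : IsSmoothProjective m Y) (hZ : IsSmoothProjective n Z)
    (hYZ : IsSmoothProjective d (Y ⊗ Z)) (hHCY : HodgeConjectureFor m Y) (hHCZ : HodgeConjectureFor n Z)
    (hdis : ∀ c i j : ℕ, 2 ≤ c → 1 ≤ i → i ≤ m → 1 ≤ j → j ≤ n → i + j = 2 * c →
      0 < Module.finrank ℚ (bettiCohomology Y i) → 0 < Module.finrank ℚ (bettiCohomology Z j) →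
      (∀ a', i = 2 * a' → (BettiUniverse.hodge hHD hY (2 * a')).hodgeClasses a' ≠ ⊤) → (∀ b', j = 2 * b' → (BettiUniverse.hodge hHD hZ (2 * b')).hodgeClasses b' ≠ ⊤) →
      ∀ P Q : ℕ, P + Q = i → P ≤ c → Q ≤ c →
        (BettiUniverse.hodge hHD hY i).hodgeNumber P Q * (BettiUniverse.hodge hHD hZ j).hodgeNumber ((c - P : ℕ) : ℤ) ((c - Q : ℕ) : ℤ) = 0) :
    HodgeConjectureFor d (Y ⊗ Z) := by
  refine BettiUniverse.hodgeConjectureFor_tensor_of_forall_reducedWindow_hodgeNumber_mul_eq_zero hHD hY hZ hYZ hHCY hHCZ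
    fun c i j hc hi him hj hjn hij hbY hbZ hnY hnZ P Q hPQ ↦ ?_
  by_cases hP0 : P < 0
  · rw [BettiUniverse.hodgeNumber_hodge_eq_zero_of_neg_left hHD hY i Q hP0, zero_mul]
  by_cases hQ0 : Q < 0
  · rw [BettiUniverse.hodgeNumber_hodge_eq_zero_of_neg_right hHD hY i P hQ0, zero_mul]
  by_cases hPc : (c : ℤ) < P
  · rw [BettiUniverse.hodgeNumber_hodge_eq_zero_of_neg_left hHD hZ j _ (by omega : (c : ℤ) - P < 0), mul_zero]
  by_cases hQc : (c : ℤ) < Q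
  · rw [BettiUniverse.hodgeNumber_hodge_eq_zero_of_neg_right hHD hZ j _ (by omega : (c : ℤ) - Q < 0), mul_zero]
  obtain ⟨P', rfl⟩ : ∃ P' : ℕ, (P' : ℤ) = P := ⟨P.toNat, Int.toNat_of_nonneg (by omega)⟩
  obtain ⟨Q', rfl⟩ : ∃ Q' : ℕ, (Q' : ℤ) = Q := ⟨Q.toNat, Int.toNat_of_nonneg (by omega)⟩
  have e₁ : (c : ℤ) - P' = ((c - P' : ℕ) : ℤ) := by omega
  have e₂ : (c : ℤ) - Q' = ((c - Q' : ℕ) : ℤ) := by omega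
  rw [e₁, e₂]
  exact hdis c i j hc hi him hj hjn hij hbY hbZ hnY hnZ P' Q' (by omega) (by omega) (by omega)

/-! ### §3 A threefold times an `n`-fold -/

/-- **`HC(T × X)` for a smooth projective threefold `T` and a smooth projective `n`-fold `X` with `HC(X)`, in Hodge numbers.**  The reduced window of `T × X` consists of the pieces
`H¹(T) ⊗ H^{2b+1}(X)` (`1 ≤ b`), `H²(T) ⊗ H^{2b}(X)` (`1 ≤ b`) and `H³(T) ⊗ H^{2b+1}(X)` (`0 ≤ b`) of `H^{2c}(T × X)`, `c = b + 1`, `b + 1`, `b + 2`; the types of `H¹(T)`, `H³(T)` are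
`(1,0)`, `(0,1)` and `(3,0)`, `(2,1)`, `(1,2)`, `(0,3)`, complementary (to `(c,c)`) to the types `(b, b+1)`, `(b+1, b)` and `(b−1, b+2)`, `(b, b+1)`, `(b+1, b)`, `(b+2, b−1)` of `H^{2b+1}(X)`; the piece
`H²(T) ⊗ H^{2b}(X)` always contains `h^{1,1}(T) h^{b,b}(X) ≠ 0` worth of type `(c,c)` and must drop out of the reduced window (`h^{2,0}(T) = 0`, i.e. `Hdg¹(H²(T)) = H²(T;ℚ)`, or `Hdgᵇ(H^{2b}(X)) =
H^{2b}(X;ℚ)`).  Hence: `HC(X)`, `h^{2,1}(T)·h^{b,b+1}(H^{2b+1}X) = 0` (`2b + 1 ≤ n`), `h^{1,0}(T)·h^{b,b+1}(H^{2b+1}X) = 0` (`1 ≤ b`, `2b + 1 ≤ n`), `h^{3,0}(T)·h^{u,u+3}(H^{2u+3}X) = 0` (`2u + 3 ≤ n`) and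
[`h^{2,0}(T) = 0` or `Hdgᵇ(H^{2b}(X)) = ⊤`] (`1 ≤ b`, `2b ≤ n`) imply `HC(T × X)` (`HC(T)` is the tree's `hodgeConjectureFor_of_dim_le_three_holds`).
[cite: VoisinHodgeI2002, §7.1.1, §6.1.3 Cor. 6.13, §11.3.3 Thm. 11.38–11.40, Lemma 11.41 and pp. 285–287, §11.3.1 Thm. 11.30] [cite: VoisinHodgeII2003, §9.2.4 Prop. 9.20, §10.2.3 proof of Prop. 10.26]
[cite: DeligneHodgeII1971, 1.2.5 and 2.1.13] [cite: Deligne2000, §1] -/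
theorem BettiUniverse.hodgeConjectureFor_threefold_tensor_of_hodgeNumber_mul_eq_zero (hHD : exists_isReal_hodgeModel) (hT : IsSmoothProjective 3 T) (hX : IsSmoothProjective n X)
    (hTX : IsSmoothProjective d (T ⊗ X)) (hHCX : HodgeConjectureFor n X)
    (h21 : ∀ b : ℕ, 2 * b + 1 ≤ n → (BettiUniverse.hodge hHD hT 3).hodgeNumber 2 1 * (BettiUniverse.hodge hHD hX (2 * b + 1)).hodgeNumber b (b + 1) = 0)
    (h10 : ∀ b : ℕ, 1 ≤ b → 2 * b + 1 ≤ n → (BettiUniverse.hodge hHD hT 1).hodgeNumber 1 0 * (BettiUniverse.hodge hHD hX (2 * b + 1)).hodgeNumber b (b + 1) = 0)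
    (h30 : ∀ u : ℕ, 2 * u + 3 ≤ n → (BettiUniverse.hodge hHD hT 3).hodgeNumber 3 0 * (BettiUniverse.hodge hHD hX (2 * u + 3)).hodgeNumber u (u + 3) = 0)
    (h20 : ∀ b : ℕ, 1 ≤ b → 2 * b ≤ n → (BettiUniverse.hodge hHD hT 2).hodgeNumber 2 0 = 0 ∨ (BettiUniverse.hodge hHD hX (2 * b)).hodgeClasses b = ⊤) :
    HodgeConjectureFor d (T ⊗ X) := by
  refine BettiUniverse.hodgeConjectureFor_tensor_of_forall_reducedWindow_hodgeNumber_mul_eq_zero hHD hT hX hTX (hodgeConjectureFor_of_dim_le_three_holds le_rfl hT) hHCX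
    fun c i j hc hi him hj hjn hij _ _ hnT hnX P Q hPQ ↦ ?_
  -- a negative index on the `T` side kills the product
  by_cases hP0 : P < 0
  · rw [BettiUniverse.hodgeNumber_hodge_eq_zero_of_neg_left hHD hT i Q hP0, zero_mul]
  by_cases hQ0 : Q < 0
  · rw [BettiUniverse.hodgeNumber_hodge_eq_zero_of_neg_right hHD hT i P hQ0, zero_mul]
  have hi3 : i ≤ 3 := him
  interval_cases i
  · -- `H¹(T) ⊗ H^{2b+1}(X)`, `c = b + 1`, `1 ≤ b`
    obtain ⟨b, rfl⟩ : ∃ b, j = 2 * b + 1 := ⟨c - 1, by omega⟩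
    obtain rfl : c = b + 1 := by omega
    have key := h10 b (by omega) hjn
    rcases (show P = 0 ∧ Q = 1 ∨ P = 1 ∧ Q = 0 by omega) with ⟨rfl, rfl⟩ | ⟨rfl, rfl⟩
    · -- type `(0,1)` of `H¹(T)` against `(b+1, b)` of `H^{2b+1}(X)`
      rw [BettiUniverse.hodgeNumber_hodge_symm hHD hT 1 (1 : ℤ) 0, BettiUniverse.hodgeNumber_hodge_symm hHD hX (2 * b + 1) (b : ℤ) (b + 1)] at key
      convert key using 3 <;> omega
    · convert key using 3 <;> omega
  · -- `H²(T) ⊗ H^{2b}(X)` is not in the reduced window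
    obtain ⟨b, rfl⟩ : ∃ b, j = 2 * b := ⟨c - 1, by omega⟩
    rcases h20 b (by omega) hjn with h | h
    · exact (hnT 1 (by omega) ((BettiUniverse.hodgeClasses_hodge_two_eq_top_iff hHD hT).2 h)).elim
    · exact (hnX b rfl h).elim
  · -- `H³(T) ⊗ H^{2c−3}(X)`
    rcases (show P = 0 ∧ Q = 3 ∨ P = 1 ∧ Q = 2 ∨ P = 2 ∧ Q = 1 ∨ P = 3 ∧ Q = 0 by omega) with ⟨rfl, rfl⟩ | ⟨rfl, rfl⟩ | ⟨rfl, rfl⟩ | ⟨rfl, rfl⟩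
    · -- `(0,3)` against `(c, c−3)`: void for `c = 2`, else `c = u + 3`, `j = 2u + 3`
      by_cases hc2 : c = 2
      · subst hc2
        rw [BettiUniverse.hodgeNumber_hodge_eq_zero_of_neg_right hHD hX j _ (by norm_num : ((2 : ℕ) : ℤ) - 3 < 0), mul_zero]
      obtain ⟨u, rfl⟩ : ∃ u, j = 2 * u + 3 := ⟨c - 3, by omega⟩
      obtain rfl : c = u + 3 := by omega
      have key := h30 u hjn
      rw [BettiUniverse.hodgeNumber_hodge_symm hHD hT 3 (3 : ℤ) 0, BettiUniverse.hodgeNumber_hodge_symm hHD hX (2 * u + 3) (u : ℤ) (u + 3)] at key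
      convert key using 3 <;> omega
    · -- `(1,2)` against `(c−1, c−2) = (b+1, b)`, `c = b + 2`, `j = 2b + 1`
      obtain ⟨b, rfl⟩ : ∃ b, j = 2 * b + 1 := ⟨c - 2, by omega⟩
      obtain rfl : c = b + 2 := by omega
      have key := h21 b hjn
      rw [BettiUniverse.hodgeNumber_hodge_symm hHD hT 3 (2 : ℤ) 1, BettiUniverse.hodgeNumber_hodge_symm hHD hX (2 * b + 1) (b : ℤ) (b + 1)] at key
      convert key using 3 <;> omega
    · -- `(2,1)` against `(c−2, c−1) = (b, b+1)`
      obtain ⟨b, rfl⟩ : ∃ b, j = 2 * b + 1 := ⟨c - 2, by omega⟩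
      obtain rfl : c = b + 2 := by omega
      have key := h21 b hjn
      convert key using 3 <;> omega
    · -- `(3,0)` against `(c−3, c)`: void for `c = 2`, else `(u, u+3)`
      by_cases hc2 : c = 2
      · subst hc2
        rw [BettiUniverse.hodgeNumber_hodge_eq_zero_of_neg_left hHD hX j _ (by norm_num : ((2 : ℕ) : ℤ) - 3 < 0), mul_zero]
      obtain ⟨u, rfl⟩ : ∃ u, j = 2 * u + 3 := ⟨c - 3, by omega⟩
      obtain rfl : c = u + 3 := by omega
      have key := h30 u hjn
      convert key using 3 <;> omega

/-! ### §4 Two threefolds -/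

/-- **`HC(T × T')`, unconditionally, for every pair of smooth projective threefolds with `h^{1,0}(T)·h^{2,1}(T') = 0`, `h^{2,1}(T)·h^{1,0}(T') = 0`, `h^{2,0}(T)·h^{2,0}(T') = 0`,
`h^{3,0}(T)·h^{3,0}(T') = 0` and `h^{2,1}(T)·h^{2,1}(T') = 0`.**  The reduced window of `T × T'` has the pieces `H¹ ⊗ H'³`, `H² ⊗ H'²`, `H³ ⊗ H'¹` of `H⁴` and `H³ ⊗ H'³` of `H⁶`; the five products
are the pairs of complementary types (`(1,0)+(1,2)`, `(2,1)+(0,1)`, `(3,0)+(0,3)`, `(2,1)+(1,2)`) plus the dropping-out of `H² ⊗ H'²`; `HC(T)`, `HC(T')` are the tree's `hodgeConjectureFor_of_dim_le_three_holds`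
(§3 with `X = T'`).  Compare the tree's `BettiUniverse.hodgeConjectureFor_tensor_threefolds_of_hom` (hypotheses on the `Hom_HS` spaces). [cite: VoisinHodgeI2002, §7.1.1, §6.1.3 Cor. 6.13, §11.3.3 Thm. 11.38–11.40, Lemma 11.41 and pp. 285–287, §11.3.1 Thm. 11.30]
[cite: VoisinHodgeII2003, §9.2.4 Prop. 9.20, §10.2.3 proof of Prop. 10.26] [cite: DeligneHodgeII1971, 1.2.5 and 2.1.13] [cite: Deligne2000, §1] -/
theorem BettiUniverse.hodgeConjectureFor_tensor_threefolds_of_hodgeNumber_mul_eq_zero (hHD : exists_isReal_hodgeModel) (hT : IsSmoothProjective 3 T) (hT' : IsSmoothProjective 3 T')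
    (hTT' : IsSmoothProjective d (T ⊗ T'))
    (h1 : (BettiUniverse.hodge hHD hT 1).hodgeNumber 1 0 * (BettiUniverse.hodge hHD hT' 3).hodgeNumber 2 1 = 0)
    (h2 : (BettiUniverse.hodge hHD hT 3).hodgeNumber 2 1 * (BettiUniverse.hodge hHD hT' 1).hodgeNumber 1 0 = 0)
    (h3 : (BettiUniverse.hodge hHD hT 2).hodgeNumber 2 0 * (BettiUniverse.hodge hHD hT' 2).hodgeNumber 2 0 = 0)
    (h4 : (BettiUniverse.hodge hHD hT 3).hodgeNumber 3 0 * (BettiUniverse.hodge hHD hT' 3).hodgeNumber 3 0 = 0)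
    (h5 : (BettiUniverse.hodge hHD hT 3).hodgeNumber 2 1 * (BettiUniverse.hodge hHD hT' 3).hodgeNumber 2 1 = 0) : HodgeConjectureFor d (T ⊗ T') := by
  refine BettiUniverse.hodgeConjectureFor_threefold_tensor_of_hodgeNumber_mul_eq_zero hHD hT hT' hTT' (hodgeConjectureFor_of_dim_le_three_holds le_rfl hT')
    (fun b hb ↦ ?_) (fun b hb1 hb ↦ ?_) (fun u hu ↦ ?_) (fun b hb1 hb ↦ ?_)
  · -- `h^{2,1}(T) · h^{b,b+1}(H^{2b+1}(T'))`, `b ∈ {0, 1}`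
    obtain rfl | rfl : b = 0 ∨ b = 1 := by omega
    · have key := h2
      rw [BettiUniverse.hodgeNumber_hodge_symm hHD hT' 1 (1 : ℤ) 0] at key
      convert key using 3 <;> norm_num
    · have key := h5
      rw [BettiUniverse.hodgeNumber_hodge_symm hHD hT' 3 (2 : ℤ) 1] at key
      convert key using 3 <;> norm_num
  · -- `h^{1,0}(T) · h^{1,2}(H³(T'))`
    obtain rfl : b = 1 := by omega
    have key := h1
    rw [BettiUniverse.hodgeNumber_hodge_symm hHD hT' 3 (2 : ℤ) 1] at key
    convert key using 3 <;> norm_num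
  · -- `h^{3,0}(T) · h^{0,3}(H³(T'))`
    obtain rfl : u = 0 := by omega
    have key := h4
    rw [BettiUniverse.hodgeNumber_hodge_symm hHD hT' 3 (3 : ℤ) 0] at key
    convert key using 3 <;> norm_num
  · -- the piece `H²(T) ⊗ H²(T')` drops out
    obtain rfl : b = 1 := by omega
    rcases mul_eq_zero.1 h3 with h | h
    · exact Or.inl h
    · exact Or.inr ((BettiUniverse.hodgeClasses_hodge_two_eq_top_iff hHD hT').2 h)

/-- **`HC(T × T')` for every smooth projective threefold `T'` with `h^{1,0}(T') = h^{2,0}(T') = h^{2,1}(T') = 0`** (e.g. a rigid Calabi–Yau threefold) **and every smooth projective threefold `T` with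
`h^{3,0}(T)·h^{3,0}(T') = 0`** (so `h^{3,0}(T) = 0` if `h^{3,0}(T') ≠ 0`). [cite: VoisinHodgeI2002, §7.1.1, §11.3.3 Thm. 11.38–11.40, Lemma 11.41 and pp. 285–287, §11.3.1 Thm. 11.30] [cite: VoisinHodgeII2003, §10.2.3 proof of Prop. 10.26]
[cite: DeligneHodgeII1971, 1.2.5 and 2.1.13] [cite: Deligne2000, §1] -/
theorem BettiUniverse.hodgeConjectureFor_tensor_threefolds_of_hodgeNumber_eq_zero_right (hHD : exists_isReal_hodgeModel) (hT : IsSmoothProjective 3 T) (hT' : IsSmoothProjective 3 T')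
    (hTT' : IsSmoothProjective d (T ⊗ T')) (h10 : (BettiUniverse.hodge hHD hT' 1).hodgeNumber 1 0 = 0) (h20 : (BettiUniverse.hodge hHD hT' 2).hodgeNumber 2 0 = 0)
    (h21 : (BettiUniverse.hodge hHD hT' 3).hodgeNumber 2 1 = 0) (h30 : (BettiUniverse.hodge hHD hT 3).hodgeNumber 3 0 * (BettiUniverse.hodge hHD hT' 3).hodgeNumber 3 0 = 0) :
    HodgeConjectureFor d (T ⊗ T') :=
  BettiUniverse.hodgeConjectureFor_tensor_threefolds_of_hodgeNumber_mul_eq_zero hHD hT hT' hTT' (by rw [h21, mul_zero]) (by rw [h10, mul_zero]) (by rw [h20, mul_zero]) h30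
    (by rw [h21, mul_zero])

/-- **`HC(T × T')` for every smooth projective threefold `T` with `h^{1,0}(T) = h^{2,0}(T) = h^{2,1}(T) = 0` and every smooth projective threefold `T'` with `h^{3,0}(T)·h^{3,0}(T') = 0`** (the mirror
of `…_right`). [cite: VoisinHodgeI2002, §7.1.1, §11.3.3 Thm. 11.38–11.40, Lemma 11.41 and pp. 285–287, §11.3.1 Thm. 11.30] [cite: VoisinHodgeII2003, §10.2.3 proof of Prop. 10.26] [cite: DeligneHodgeII1971, 1.2.5 and 2.1.13]
[cite: Deligne2000, §1] -/
theorem BettiUniverse.hodgeConjectureFor_tensor_threefolds_of_hodgeNumber_eq_zero_left (hHD : exists_isReal_hodgeModel) (hT : IsSmoothProjective 3 T) (hT' : IsSmoothProjective 3 T')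
    (hTT' : IsSmoothProjective d (T ⊗ T')) (h10 : (BettiUniverse.hodge hHD hT 1).hodgeNumber 1 0 = 0) (h20 : (BettiUniverse.hodge hHD hT 2).hodgeNumber 2 0 = 0)
    (h21 : (BettiUniverse.hodge hHD hT 3).hodgeNumber 2 1 = 0) (h30 : (BettiUniverse.hodge hHD hT 3).hodgeNumber 3 0 * (BettiUniverse.hodge hHD hT' 3).hodgeNumber 3 0 = 0) :
    HodgeConjectureFor d (T ⊗ T') :=
  BettiUniverse.hodgeConjectureFor_tensor_threefolds_of_hodgeNumber_mul_eq_zero hHD hT hT' hTT' (by rw [h10, zero_mul]) (by rw [h21, zero_mul]) (by rw [h20, zero_mul]) h30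
    (by rw [h21, zero_mul])

/-- **`HC(T × T)` for every smooth projective threefold `T` with `h^{2,0}(T) = h^{3,0}(T) = h^{2,1}(T) = 0`** (any irregularity `h^{1,0}(T)`; the self-product case `T' = T` of the five-product
criterion). [cite: VoisinHodgeI2002, §7.1.1, §11.3.3 Thm. 11.38–11.40, Lemma 11.41 and pp. 285–287, §11.3.1 Thm. 11.30] [cite: VoisinHodgeII2003, §10.2.3 proof of Prop. 10.26] [cite: DeligneHodgeII1971, 1.2.5 and 2.1.13] [cite: Deligne2000, §1] -/
theorem BettiUniverse.hodgeConjectureFor_tensor_self_threefold_of_hodgeNumber_eq_zero (hHD : exists_isReal_hodgeModel) (hT : IsSmoothProjective 3 T) (hTT : IsSmoothProjective d (T ⊗ T))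
    (h20 : (BettiUniverse.hodge hHD hT 2).hodgeNumber 2 0 = 0) (h30 : (BettiUniverse.hodge hHD hT 3).hodgeNumber 3 0 = 0) (h21 : (BettiUniverse.hodge hHD hT 3).hodgeNumber 2 1 = 0) :
    HodgeConjectureFor d (T ⊗ T) :=
  BettiUniverse.hodgeConjectureFor_tensor_threefolds_of_hodgeNumber_mul_eq_zero hHD hT hT hTT (by rw [h21, mul_zero]) (by rw [h21, zero_mul]) (by rw [h20, mul_zero])
    (by rw [h30, mul_zero]) (by rw [h21, mul_zero])

end Literature.AlgebraicGeometry.HodgeTheory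

end
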